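import Summits.ABC.IUTFork.Joshi.FundamentalEstimateBLCorollaries
import Mathlib.Analysis.SpecialFunctions.Pow.Continuity

/-!
# [J-III] Def. 7.2.7 / Cor. 7.4.1 — the `sup` over `ρ ∈ (0,1]`: a faithfulness flag made kernel-hard (interface level)

Companion of `Joshi/FundamentalEstimateBL.lean` (p428437) and `Joshi/FundamentalEstimateBLCorollaries.lean` (p428908); abc-iut cell
block E (rung LADDER-ABC:A2.E), seat abc-iut-E-t12, slot T-12 / plan/E/OBJECTS.tsv O-024, nodes J3:Def7.2.7, J3:Thm7.3.1, J3:Cor7.4.1.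
SOURCE: K. Joshi, arXiv:2401.13508**v4** (unrefereed; bib `Joshi2024ATS3`), §7.2–§7.4, PDF pp.54–57; the norms are those of
[FF18] = Fargues–Fontaine, *Courbes et fibrés vectoriels en théorie de Hodge p-adique*, §1.4 (for `x = Σ_n [x_n] π^n ∈ B^b`:
`|x|_ρ = sup_n |x_n| ρ^n`, so `|π|_ρ = ρ`, `|[a]|_ρ = |a|`, and `|φ(x)|_{ρ^q} = |x|_ρ^q`). Object-side file (E-PLAN R14): no decl of OUR
side is bound. NOT on the S-spine (class P2); recorded for the referee lanes (E-ref) and §M honesty; no side taken.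

THE FLAG (F-d)/(F-c) OF THE COROLLARIES FILE, SHARPENED. Def. 7.2.7 (p.54 l.61–76) takes `|Θ̃^{B_{L′}}_Joshi|_{B_{L′}} := sup` over ALL
`ρ ∈ (0,1]`, and the proof of Cor. 7.4.1 (p.57 l.3–8) says of a special precompact `Φ` that "`sup_{0<ρ<1} |Φ|_{B_{L′},ρ}` is evidently
bounded". OUR READING (model level, to be double-read by E-ref / E-cx — no single-point elimination): in [FF18]'s `B_E` every
nonzero Frobenius eigenvector `τ` (`φ(τ) = π·τ`; e.g. the periods `t_{K_{y′}} ∈ 𝔪_{y′}` of the admissible lifts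
`[z_j] + i_j(λ)·t_{K_{y′_j}}`, Def. 6.4.3.1 p.47 l.42–86, and the Tate-module elements `τ ∈ T_y ⊂ B^{φ=p}` of [J-IIp] Prop. 7.4.2) has
`g(ρ) := |τ|_ρ` satisfying `g(ρ^q) = (g(ρ)/ρ)^q` on `(0,1)` (from `|φ(τ)|_{ρ^q} = |τ|_ρ^q` and `|π τ|_{ρ^q} = ρ^q |τ|_{ρ^q}`), and §1 below
PROVES (pure real analysis) that such a `g` with one positive value is UNBOUNDED as `ρ → 0⁺` (`g(σ^{q^n}) = (g(σ)/σ^n)^{q^n}`).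
Consequences of the reading: (i) as soon as the locus contains one admissible lift with `λ ≠ 0` at one `w ∈ 𝕍^{odd,ss}` (Def. 6.4.3.1
allows every `λ ∈ 𝒪_E`), `|Θ̃^{B_{L′}}_Joshi|_{B_{L′}} = +∞`, so the conclusion of Thm. 7.3.1 holds TRIVIALLY and its content is the
fixed-`ρ` bound its proof actually shows (`LocalThetaEstimateAt ρ ⟹ qBound ≤ |Ξ^α_{0,z_Θ}|_{B_{L′},ρ} ≤ |Θ̃|_{B_{L′},ρ}`, typed in
p428437) together with Cor. 7.4.2 (`ρ = 1`); (ii) Cor. 7.4.1's "`∞ > |Φ|_{B_{L′}}`" FAILS for the special precompact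
`Φ_w = {Ξ^{α_w}_{0,z_Θ,w}, Ξ^{α_w}_{λ,z_Θ,w}}` (two points: compact) — "evidently bounded" conflates Fréchet-boundedness (each `|·|_ρ`
bounded) with boundedness UNIFORM in `ρ`, which is the typed hypothesis `UniformNormBound` of p428908. Minimal repair `C′`: sizes at a
fixed `ρ`, or `sup` over a compact `[ρ₀, 1]`.

KERNEL CONTENT (interface level; the tree has no Fargues–Fontaine ring, so the model-level sentences above stay a READING):
§1 `exists_lt_of_frobeniusScaling` — the growth lemma; §2 an `AdelicThetaDatum` `flatDatum` satisfying the WHOLE typed signature of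
§7.1–7.4 (norms `|x|^{1/ρ}`: continuous, `= 1` on `[1]`, `≤ 1` on `B^+` at `ρ = 1`) with a special precompact `Φ ⊆ Θ̃` of INFINITE size
(`size_flatPhi_eq_top`), hence `¬ flatDatum.Cor741` (`not_cor741_flatDatum`): Cor. 7.4.1 is NOT a consequence of the §7.2/§7.4
signature + precompactness + continuity of the norms — its printed proof needs exactly `UniformNormBound`, and (§1) that
uniformity is what Frobenius eigen-components destroy. FRAMING (binding): typed ≠ proved; no side taken on [IUTchIII] Cor. 3.12,
on Joshi's claims or on Mochizuki's 2024 report; nothing here bears on abc; a flag on a P2 corollary, not on the S-spine.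
-/

noncomputable section

open Set Finset

namespace Summit.ABC.IUTFork.Joshi.ATS3

/-! ## 1. The growth lemma for Frobenius eigenvectors (pure real analysis) -/

/-- Iterating the FROBENIUS SCALING LAW `g(ρ^q) = (g(ρ)/ρ)^q` ([FF18] §1.4: `|φ(x)|_{ρ^q} = |x|_ρ^q`, `|π|_ρ = ρ`, applied to
`φ(τ) = π τ`): `g(σ^{q^n}) = (g(σ)/σ^n)^{q^n}`. [folklore] -/
theorem frobeniusScaling_iterate {q : ℕ} (hq : 1 ≤ q) {g : ℝ → ℝ}
    (hscale : ∀ ρ ∈ Set.Ioo (0 : ℝ) 1, g (ρ ^ q) = (g ρ / ρ) ^ q)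
    {σ : ℝ} (hσ : σ ∈ Set.Ioo (0 : ℝ) 1) (n : ℕ) : g (σ ^ (q ^ n)) = (g σ / σ ^ n) ^ (q ^ n) := by
  induction n with
  | zero => simp
  | succ n ih =>
    have hσn : σ ^ (q ^ n) ∈ Set.Ioo (0 : ℝ) 1 :=
      ⟨pow_pos hσ.1 _, pow_lt_one₀ hσ.1.le hσ.2 (pow_ne_zero _ (by omega))⟩
    rw [pow_succ, pow_mul, hscale _ hσn, ih, ← div_pow, ← pow_mul, div_div, ← pow_succ]

/-- **A nonzero Frobenius eigenvector has UNBOUNDED norms as `ρ → 0⁺`**: if `g ≥ 0`-valued data on `(0,1)` obey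
`g(ρ^q) = (g(ρ)/ρ)^q` with `q ≥ 1` and `g(σ) > 0` at one `σ ∈ (0,1)`, then `g` exceeds every bound on `(0,1)` (at `ρ = σ^{q^n}`,
`g = (g(σ)/σ^n)^{q^n} ≥ g(σ)/σ^n → ∞`). Applied (as a READING) to `g(ρ) = |τ|_ρ`, `τ = t_{K_{y′}}` or `τ ∈ T_y ⊂ B^{φ=p}`:
`sup_{ρ∈(0,1)} |τ|_ρ = +∞`. [folklore] -/
theorem exists_lt_of_frobeniusScaling {q : ℕ} (hq : 1 ≤ q) {g : ℝ → ℝ}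
    (hscale : ∀ ρ ∈ Set.Ioo (0 : ℝ) 1, g (ρ ^ q) = (g ρ / ρ) ^ q) {σ : ℝ} (hσ : σ ∈ Set.Ioo (0 : ℝ) 1) (ha : 0 < g σ)
    (M : ℝ) : ∃ ρ ∈ Set.Ioo (0 : ℝ) 1, M < g ρ := by
  obtain ⟨n, hn⟩ := exists_pow_lt_of_lt_one (div_pos ha (by positivity : (0 : ℝ) < max M 0 + 1)) hσ.2
  have hqn : q ^ n ≠ 0 := pow_ne_zero _ (by omega)
  refine ⟨σ ^ (q ^ n), ⟨pow_pos hσ.1 _, pow_lt_one₀ hσ.1.le hσ.2 hqn⟩, ?_⟩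
  rw [frobeniusScaling_iterate hq hscale hσ n]
  have hσn : 0 < σ ^ n := pow_pos hσ.1 n
  have hx : max M 0 + 1 < g σ / σ ^ n := by
    rw [lt_div_iff₀ hσn]
    calc (max M 0 + 1) * σ ^ n < (max M 0 + 1) * (g σ / (max M 0 + 1)) :=
          mul_lt_mul_of_pos_left hn (by positivity)
      _ = g σ := mul_div_cancel₀ _ (by positivity)
  have h1 : 1 ≤ g σ / σ ^ n := by linarith [le_max_right M 0]
  calc M ≤ max M 0 := le_max_left _ _
    _ < g σ / σ ^ n := by linarith
    _ ≤ (g σ / σ ^ n) ^ (q ^ n) := le_self_pow₀ h1 hqn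

/-- Hence such a `g` is not bounded on `(0,1)`: the uniform-in-`ρ` bound of the proof of Cor. 7.4.1 is exactly what Frobenius
eigen-components destroy (READING; kernel form). [folklore] -/
theorem not_bddAbove_of_frobeniusScaling {q : ℕ} (hq : 1 ≤ q) {g : ℝ → ℝ}
    (hscale : ∀ ρ ∈ Set.Ioo (0 : ℝ) 1, g (ρ ^ q) = (g ρ / ρ) ^ q) {σ : ℝ} (hσ : σ ∈ Set.Ioo (0 : ℝ) 1) (ha : 0 < g σ) :
    ¬ BddAbove (g '' Set.Ioo (0 : ℝ) 1) := by
  rintro ⟨M, hM⟩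
  obtain ⟨ρ, hρ, hlt⟩ := exists_lt_of_frobeniusScaling hq hscale hσ ha M
  exact absurd (hM (Set.mem_image_of_mem g hρ)) (not_le.2 hlt)

/-! ## 2. Interface level: Cor. 7.4.1 is not a consequence of the §7.2/§7.4 signature -/

/-- **`flatDatum`** — an `AdelicThetaDatum` satisfying the WHOLE typed signature of §7.1–7.4 whose norms grow as `ρ → 0⁺` the way a
Frobenius eigen-component does qualitatively: one place (`𝕍_{L′} = 𝕍^{odd,ss} = {∗}`), `ℓ* = 2`, `B = ℝ` with `|x|_ρ := |x|^{1/ρ}`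
(continuous; `|1|_ρ = 1`; at `ρ = 1` it is `|x|`, so `B^+ := {|x| ≤ 1}` has `|·|_1 ≤ 1`), the locus a single tuple `Ξ = (2, 2)`,
`|q| = 1/2`. Interface-level witness only — NOT a model of [FF18]'s rings. [folklore] -/
def flatDatum : AdelicThetaDatum where
  W := Unit
  Vss := Finset.univ
  lstar := 2
  two_le_lstar := le_rfl
  prime_ell := Nat.prime_five
  B := fun _ => ℝ
  one := fun _ => 1
  nrm := fun _ ρ x => |x| ^ (1 / ρ)
  nrm_nonneg := fun _ ρ x => Real.rpow_nonneg (abs_nonneg x) _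
  nrm_one := fun _ ρ => by simp
  top := fun _ => inferInstance
  continuous_nrm := fun _ ρ hρ => continuous_abs.rpow_const fun _ => Or.inr (by
    have := hρ.1; positivity)
  Bplus := fun _ => {x | |x| ≤ 1}
  nrm_le_one_of_mem_Bplus := fun _ x hx => by simpa using hx
  Idx := Unit
  Xi := fun _ _ _ => 2
  Xi_off := fun _ w hw => absurd (Finset.mem_univ w) hw
  std := ()
  qAbs := fun _ => 1 / 2
  qAbs_pos := fun _ _ => by norm_num
  qAbs_lt_one := fun _ _ => by norm_num

/-- The special precompact family of `flatDatum`: at the (only, bad) place the singleton `{Ξ}`. [folklore] -/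
def flatPhi : ∀ w : flatDatum.W, Set (Fin flatDatum.lstar → flatDatum.B w) := fun w => {flatDatum.Xi flatDatum.std w}

/-- `flatPhi` is special precompact in the sense of §7.4 (a singleton is compact). [folklore] -/
theorem flatPhi_isSpecialPrecompact : flatDatum.IsSpecialPrecompact flatPhi where
  std_mem := fun _ => rfl
  precompact := fun w _ => by
    show IsCompact (closure ({fun _ : Fin 2 => (2 : ℝ)} : Set (Fin 2 → ℝ)))
    rw [closure_singleton]
    exact isCompact_singleton
  eq_one_off := fun w hw => absurd (Finset.mem_univ (α := Unit) w) hw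

/-- `∏_w Φ_w ⊆ Θ̃` for `flatDatum` (both are `{Ξ}`). [folklore] -/
theorem pi_flatPhi_subset_locus : flatDatum.pi flatPhi ⊆ flatDatum.locus := by
  intro x hx
  refine ⟨(), funext fun w => ?_⟩
  exact ((hx w (Set.mem_univ w)).symm : _)

/-- At `ρ = 1/(n+1)` the local size of `Ξ = (2,2)` is `(2^{n+1})^2`. [folklore] -/
theorem localSize_flat (n : ℕ) (w : flatDatum.W) :
    flatDatum.localSize w (1 / ((n : ℝ) + 1)) (flatDatum.Xi flatDatum.std w) = ((2 : ℝ) ^ (n + 1)) ^ 2 := by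
  have h2 : |(2 : ℝ)| ^ (1 / (1 / ((n : ℝ) + 1))) = (2 : ℝ) ^ (n + 1) := by
    rw [abs_of_pos (by norm_num : (0 : ℝ) < 2), one_div_one_div, ← Real.rpow_natCast]
    norm_num
  show ∏ _j : Fin 2, |(2 : ℝ)| ^ (1 / (1 / ((n : ℝ) + 1))) = ((2 : ℝ) ^ (n + 1)) ^ 2
  rw [Fin.prod_const, h2]

/-- `𝕍^{odd,ss}` of `flatDatum` has one element. [folklore] -/
theorem card_Vss_flat : flatDatum.Vss.card = 1 := by rfl

/-- At `ρ = 1/(n+1)` the size of `Ξ = (2,2)` is `(2^{n+1})^2`. [folklore] -/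
theorem adelicSize_flat (n : ℕ) :
    flatDatum.adelicSize (1 / ((n : ℝ) + 1)) (flatDatum.Xi flatDatum.std) = ((2 : ℝ) ^ (n + 1)) ^ 2 := by
  rw [flatDatum.adelicSize_Xi_eq_prod, Finset.prod_congr rfl fun w _ => localSize_flat n w, Finset.prod_const,
    card_Vss_flat, pow_one]

/-- **The special precompact `Φ ⊆ Θ̃` of `flatDatum` has INFINITE size `|Φ|_{B_{L′}} = +∞`** (the norms are bounded at each fixed
`ρ` but not uniformly in `ρ`). [folklore] -/
theorem size_flatPhi_eq_top : flatDatum.size (flatDatum.pi flatPhi) = ⊤ := by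
  by_contra h
  have hle : ∀ n : ℕ, ((((2 : ℝ) ^ (n + 1)) ^ 2 : ℝ) : EReal) ≤ flatDatum.size (flatDatum.pi flatPhi) := fun n => by
    rw [← adelicSize_flat n]
    refine flatDatum.adelicSize_le_size (flatDatum.Xi_std_mem_pi flatPhi_isSpecialPrecompact) ⟨by positivity, ?_⟩
    rw [div_le_one (by positivity)]
    linarith [(Nat.cast_nonneg n : (0 : ℝ) ≤ n)]
  set s := flatDatum.size (flatDatum.pi flatPhi) with hs
  have hreal : ∀ n : ℕ, ((2 : ℝ) ^ (n + 1)) ^ 2 ≤ s.toReal := fun n => by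
    have h1 := (hle n).trans (EReal.le_coe_toReal h)
    exact EReal.coe_le_coe_iff.1 h1
  obtain ⟨n, hn⟩ := pow_unbounded_of_one_lt s.toReal (by norm_num : (1 : ℝ) < 4)
  have h4 : (4 : ℝ) ^ n ≤ ((2 : ℝ) ^ (n + 1)) ^ 2 := by
    rw [← pow_mul, Nat.mul_comm (n + 1) 2, pow_mul]
    have h22 : (2 : ℝ) ^ 2 = 4 := by norm_num
    rw [h22]
    exact pow_le_pow_right₀ (by norm_num) (Nat.le_succ n)
  exact absurd ((h4.trans (hreal n)).trans_lt hn) (lt_irrefl _)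

/-- **Cor. 7.4.1 FAILS for `flatDatum`** (interface level): the typed Corollary — "`Φ ⊆ Θ̃` special precompact ⟹ `∞ > |Φ|_{B_{L′}} > ∏|q^{1/2ℓ}|^{ℓ*}`"
— is refuted by a datum satisfying the whole §7.1–7.4 signature (continuity of the norms, `|[1]|_ρ = 1`, `|·|_1 ≤ 1` on `B^+`
included). Hence Cor. 7.4.1 is NOT derivable from the signature + precompactness: its printed proof's "evidently bounded" (p.57
l.7–8) IS the extra hypothesis `UniformNormBound` of p428908 (flag F-d), and §1 is the reason that hypothesis is delicate in
[FF18]'s `B`. A flag for the referee lanes; no side taken. [folklore] -/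
theorem not_cor741_flatDatum : ¬ flatDatum.Cor741 := fun h =>
  absurd (h flatPhi pi_flatPhi_subset_locus flatPhi_isSpecialPrecompact).1 (by rw [size_flatPhi_eq_top]; exact lt_irrefl _)

/-- … while at every FIXED `0 < ρ < 1` the same `Φ` has finite size (p428908's `sizeAt_pi_lt_top`, from precompactness +
continuity alone) — the two notions of boundedness the printed proof conflates, side by side. [folklore] -/
theorem sizeAt_flatPhi_lt_top {ρ : ℝ} (hρ : ρ ∈ Set.Ioo (0 : ℝ) 1) : flatDatum.sizeAt (flatDatum.pi flatPhi) ρ < ⊤ :=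
  flatDatum.sizeAt_pi_lt_top flatPhi_isSpecialPrecompact hρ

/-- And `UniformNormBound` indeed FAILS for `flatPhi` (it would give Cor. 7.4.1's finiteness by p428908's
`cor741_finite_of_uniformNormBound`). [folklore] -/
theorem not_uniformNormBound_flatPhi : ¬ flatDatum.UniformNormBound flatPhi := fun h =>
  absurd (flatDatum.cor741_finite_of_uniformNormBound flatPhi_isSpecialPrecompact h)
    (by rw [size_flatPhi_eq_top]; exact lt_irrefl _)

end Summit.ABC.IUTFork.Joshi.ATS3

end
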